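import Literature.Topology.FourManifolds.ExitHost
import Literature.Topology.FourManifolds.CrossingLevels
import HarnessLib

/-!
# The blow-up track of the instance host knot near the crossing

Topic `Literature/Topology/FourManifolds` (trunk T-4MAN). Fact seat
`provefact-Literature.Topology.FourManifolds.Knot.IsConnectedSum.isIsotopic` (Schubert's theorem),
geometric heart for rail knots, closure step (crossing retraction). For band-sum data `b` in
normal position with a uniform shrink scale and the **instance** wall frame (the spiked piece
function itself), the host knot `hostKnot` of `ExitHost.lean` is read near the crossing in blow-up
coordinates: `trk s = blowUp (ψ (host (circlePt s)))`.

* Parameters on the two cores with prescribed blown-up parameter (`paramLo`, `paramHi`).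
* **Zone formulas** for the track: on the lower core with `αLo ≤ 3/8` (bridge, blend, stub) it
  is the blow-up of the spiked lower piece, `(1 - β) blowUp (railLoPsi) + β modelLo`
  (`trk_coreLo_of_lt`); on the lower core with `αLo ∈ [1/4, 3/4]` left of the lower collar it is
  the lower-line point `O - ψLo dLo` (`trk_lower`); on the window it is `O + clockFn dLo`
  (`trk_window`); on the upper core with `αHi ∈ [1/4, 3/4]` right of the upper collar it is the
  bent point `bendArc σ r_A ψHi 1` (`trk_upper`); mirror bridge formula (`trk_coreHi_of_lt`).
* **The level along the track** `mu s = lev (trk s)` (`CrossingLevels.lean`) has positive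
  derivative strictly inside the excursion (`deriv_mu_pos`), hence is strictly increasing there.

Everything is proved; no named facts are introduced.

## References

* M. W. Hirsch, *Differential Topology*, GTM 33, Springer (1976), Ch. 8 §1. [HirschDT1976]
-/

open scoped Manifold ContDiff Topology Real
open Function Set Metric Filter

noncomputable section

namespace Literature.Topology.FourManifolds

/-- Local notation: `𝔼 n` is the model Euclidean space `EuclideanSpace ℝ (Fin n)`. -/
local notation "𝔼 " n:arg => EuclideanSpace ℝ (Fin n)

/-- Local notation: `𝕊 n` is the unit sphere in `EuclideanSpace ℝ (Fin (n + 1))`. -/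
local notation "𝕊 " n:arg => (Metric.sphere (0 : EuclideanSpace ℝ (Fin (n + 1))) 1)

attribute [local instance] fact_finrank_euclideanSpace_succ

open KnotsInBall ExitBend

namespace ExitBend

/-- The blown-down lower-line point in terms of the base: `O + s (base - O) = O - s dLo` with
`base = (1/4, -1, 0)`. [folklore] -/
theorem pt3_add_smul_base_sub (σ s : ℝ) : (pt3 1 0 σ : 𝔼 3) + s • (pt3 (1 / 4) (-1) 0 - pt3 1 0 σ) = lowerPt σ (-s) := by
  rw [lowerPt_eq]
  ext i; fin_cases i
  · simp; ring
  · simp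
  · simp; ring

/-- The lower model line is the lower line read by clock `-(1 - (α - 1/4)/(3/4))`. [folklore] -/
theorem lineLo_eq_lowerPt (σ α : ℝ) : lineLo σ α = lowerPt σ (-(1 - (α - 1 / 4) / (3 / 4))) := by
  ext i; fin_cases i <;> simp [lineLo, lowerPt, cO, dLo] <;> ring

/-- The upper model line is the upper ray point `O + ψ dHi`, `ψ = 1 - (α - 1/4)/(3/4)`. [folklore] -/
theorem lineHi_eq_cO_add (σ α : ℝ) : lineHi σ α = cO σ + (1 - (α - 1 / 4) / (3 / 4)) • dHi σ := by
  ext i; fin_cases i <;> simp [lineHi, cO, dHi] <;> ring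

end ExitBend

namespace BandData

variable {A B K : Knot} {avoid : Set (𝕊 3)} (b : BandData A B K avoid)

/-- The blow-down map is affine: `blowDown Y + s (blowDown Y' - blowDown Y) = blowDown (Y + s (Y' - Y))`.
[folklore] -/
theorem blowDown_add_smul_sub (hcross : b.band ⁻¹' sphereEquator 2 ∩ squareNhd b.δ = {x ∈ squareNhd b.δ | x 0 = 2⁻¹})
    (κ s : ℝ) (Y Y' : 𝔼 3) :
    b.blowDown hcross κ Y + s • (b.blowDown hcross κ Y' - b.blowDown hcross κ Y) = b.blowDown hcross κ (Y + s • (Y' - Y)) := by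
  rw [b.blowDown_sub]; simp only [blowDown, map_add, map_smul, smul_add, smul_smul, mul_comm s κ]; abel

/-- **The standing hypotheses of the instance host**: uniform shrink scale, unit scale `λ₀`,
bend radius `r_A`, hemispheres and disjointness of the summands. [folklore] -/
structure HostHyp (hcross : b.band ⁻¹' sphereEquator 2 ∩ squareNhd b.δ = {x ∈ squareNhd b.δ | x 0 = 2⁻¹})
    (ε r A' κ lam₀ rA : ℝ) : Prop where
  HU : b.ShrinkScaleU hcross ε r A' κ
  hl : lam₀ ∈ Ioc (0 : ℝ) 1
  hl2 : lam₀ ≤ 1 / 2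
  hrA : 0 < rA
  hrA8 : rA ≤ 1 / 8
  hB : B.InSouth
  hAB : Disjoint (range A) (range B)
  hA : A.InNorth

namespace HostHyp

variable {b} {hcross : b.band ⁻¹' sphereEquator 2 ∩ squareNhd b.δ = {x ∈ squareNhd b.δ | x 0 = 2⁻¹}}
  {ε r A' κ lam₀ rA : ℝ} (P : b.HostHyp hcross ε r A' κ lam₀ rA)
include P

/-- The instance wall frame. [folklore] -/
theorem hW : b.IsWallFrame P.HU.cone (b.spikePiece hcross κ b.depthSign 1) := b.isWallFrame_spikePiece P.HU.cone P.hA P.hAB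

/-- **The instance host knot.** [folklore] -/
def host : Knot :=
  b.hostKnot P.HU P.hl P.hl2 P.hW P.hrA P.hrA8 P.hB P.hAB (b.isBendClear_spikePiece P.HU.cone) P.hA

/-- The host point of parameter `s`. [folklore] -/
def hostPt (s : ℝ) : 𝕊 3 := P.host (circlePt s)

/-- The host point is the host loop. [folklore] -/
theorem coe_hostPt (s : ℝ) : ((P.hostPt s : 𝕊 3) : 𝔼 4) = b.hostLoop P.HU P.hl P.hl2 P.hW P.hrA P.hB P.hAB s :=
  b.coe_hostKnot_circlePt P.HU P.hl P.hl2 P.hW P.hrA P.hrA8 P.hB P.hAB _ P.hA s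

/-- **The blow-up track** of the host. [folklore] -/
def trk (s : ℝ) : 𝔼 3 := b.blowUp hcross κ (psiN (P.hostPt s))

/-- Reading a host point given in the chart. [folklore] -/
theorem trk_eq_of_coe_eq {s : ℝ} {Y : 𝔼 3} (h : ((P.hostPt s : 𝕊 3) : 𝔼 4) = ((psiN.symm (b.blowDown hcross κ Y) : 𝕊 3) : 𝔼 4)) :
    P.trk s = Y := by
  rw [trk, Subtype.ext h, psiN_apply_psiN_symm, b.blowUp_blowDown hcross P.HU.cone.spike.κ_pos.ne']

/-! ### Core facts -/

omit P in
/-- The lower core lies in the open fundamental domain. [folklore] -/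
theorem coreLo_subset : Icc (b.tcLo - b.epsLo / 8) (b.tcLo + b.epsLo / 8) ⊆ Ioo b.alo (b.alo + 1) := fun s hs ↦ by
  obtain ⟨h1, h2, hε⟩ := b.tcLo_window; have hm := b.marks_lt
  exact ⟨by linarith [hs.1], by linarith [hs.2]⟩

omit P in
/-- The upper core lies in the open fundamental domain. [folklore] -/
theorem coreHi_subset : Icc (b.tcHi - b.epsHi / 8) (b.tcHi + b.epsHi / 8) ⊆ Ioo b.alo (b.alo + 1) := fun s hs ↦ by
  obtain ⟨h1, h2, hε⟩ := b.tcHi_window; have hm := b.marks_lt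
  exact ⟨by linarith [hs.1], by linarith [hs.2]⟩

/-- On the lower core with `|αLo| ≤ A'` the lower rail parameter point is in the flat ball. [folklore] -/
theorem railLoParam_lt {s : ℝ} (hα : |b.alphaLo κ s| ≤ A') : ‖(pt2 (κ * b.alphaLo κ s) (-κ) : 𝔼 2)‖ < r := by
  have h := P.HU.cone.spike
  refine norm_railLoParam_lt h.κ_pos (lt_of_le_of_lt ?_ h.scale_lt_r)
  exact mul_le_mul_of_nonneg_left (by linarith) h.κ_pos.le

/-- On the upper core with `|αHi| ≤ A'` the upper rail parameter point is in the flat ball. [folklore] -/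
theorem railHiParam_lt {s : ℝ} (hα : |b.alphaHi κ s| ≤ A') : ‖(pt2 (κ * b.alphaHi κ s) κ : 𝔼 2)‖ < r := by
  have h := P.HU.cone.spike
  refine norm_railHiParam_lt h.κ_pos (lt_of_le_of_lt ?_ h.scale_lt_r)
  exact mul_le_mul_of_nonneg_left (by linarith) h.κ_pos.le

/-! ### Parameters with prescribed blown-up parameter -/

/-- A lower-core parameter with `αLo = v`, `0 ≤ v ≤ 7`, exists. [folklore] -/
theorem exists_alphaLo_eq {v : ℝ} (hv : v ∈ Icc (0 : ℝ) 7) : ∃ t ∈ Icc b.tcLo (b.tcLo + b.epsLo / 8), b.alphaLo κ t = v := by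
  have hκ := P.HU.cone.spike.κ_pos
  have hε := b.epsLo_bounds.1
  have h0 : b.alphaLo κ b.tcLo = 0 := by rw [alphaLo, chiLo_tcLo]; simp
  have h1 : 7 ≤ b.alphaLo κ (b.tcLo + b.epsLo / 8) := by
    rw [alphaLo, le_div_iff₀ hκ]
    have : b.gapLo ≤ b.chiLo (b.tcLo + b.epsLo / 8) - 1 / 2 := min_le_left _ _
    linarith [P.HU.cone.spike.seven_le_gapLo]
  have hcont : ContinuousOn (b.alphaLo κ) (Icc b.tcLo (b.tcLo + b.epsLo / 8)) := (b.contDiff_alphaLo κ).continuous.continuousOn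
  have hmem : v ∈ Icc (b.alphaLo κ b.tcLo) (b.alphaLo κ (b.tcLo + b.epsLo / 8)) := ⟨by rw [h0]; exact hv.1, by linarith [hv.2]⟩
  exact intermediate_value_Icc (by linarith) hcont hmem

/-- An upper-core parameter with `αHi = v`, `0 ≤ v ≤ 7`, exists. [folklore] -/
theorem exists_alphaHi_eq {v : ℝ} (hv : v ∈ Icc (0 : ℝ) 7) : ∃ t ∈ Icc (b.tcHi - b.epsHi / 8) b.tcHi, b.alphaHi κ t = v := by
  have hκ := P.HU.cone.spike.κ_pos
  have hε := b.epsHi_bounds.1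
  have h0 : b.alphaHi κ b.tcHi = 0 := by rw [alphaHi, chiHi_tcHi]; simp
  have h1 : 7 ≤ b.alphaHi κ (b.tcHi - b.epsHi / 8) := by
    rw [alphaHi, le_div_iff₀ hκ]
    have : b.gapHi ≤ b.chiHi (b.tcHi - b.epsHi / 8) - 1 / 2 := min_le_left _ _
    linarith [P.HU.cone.spike.seven_le_gapHi]
  have hcont : ContinuousOn (b.alphaHi κ) (Icc (b.tcHi - b.epsHi / 8) b.tcHi) := (b.contDiff_alphaHi κ).continuous.continuousOn
  have hmem : v ∈ Icc (b.alphaHi κ b.tcHi) (b.alphaHi κ (b.tcHi - b.epsHi / 8)) := ⟨by rw [h0]; exact hv.1, by linarith [hv.2]⟩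
  exact intermediate_value_Icc' (by linarith) hcont hmem

/-- **The lower-core parameter with `αLo = v`** (chosen). [folklore] -/
def paramLo {v : ℝ} (hv : v ∈ Icc (0 : ℝ) 7) : ℝ := (P.exists_alphaLo_eq hv).choose

/-- The defining property of `paramLo`. [folklore] -/
theorem paramLo_spec {v : ℝ} (hv : v ∈ Icc (0 : ℝ) 7) :
    P.paramLo hv ∈ Icc b.tcLo (b.tcLo + b.epsLo / 8) ∧ b.alphaLo κ (P.paramLo hv) = v := (P.exists_alphaLo_eq hv).choose_spec

/-- `paramLo` lies in the closed lower core. [folklore] -/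
theorem paramLo_mem_core {v : ℝ} (hv : v ∈ Icc (0 : ℝ) 7) : P.paramLo hv ∈ Icc (b.tcLo - b.epsLo / 8) (b.tcLo + b.epsLo / 8) := by
  have h := (P.paramLo_spec hv).1; have hε := b.epsLo_bounds.1
  exact ⟨by linarith [h.1], h.2⟩

/-- **The upper-core parameter with `αHi = v`** (chosen). [folklore] -/
def paramHi {v : ℝ} (hv : v ∈ Icc (0 : ℝ) 7) : ℝ := (P.exists_alphaHi_eq hv).choose

/-- The defining property of `paramHi`. [folklore] -/
theorem paramHi_spec {v : ℝ} (hv : v ∈ Icc (0 : ℝ) 7) :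
    P.paramHi hv ∈ Icc (b.tcHi - b.epsHi / 8) b.tcHi ∧ b.alphaHi κ (P.paramHi hv) = v := (P.exists_alphaHi_eq hv).choose_spec

/-- `paramHi` lies in the closed upper core. [folklore] -/
theorem paramHi_mem_core {v : ℝ} (hv : v ∈ Icc (0 : ℝ) 7) : P.paramHi hv ∈ Icc (b.tcHi - b.epsHi / 8) (b.tcHi + b.epsHi / 8) := by
  have h := (P.paramHi_spec hv).1; have hε := b.epsHi_bounds.1
  exact ⟨h.1, by linarith [h.2]⟩

/-- **Comparison on the lower core**: `αLo s ≤ v ↔ s ≤ paramLo v`. [folklore] -/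
theorem alphaLo_le_iff {v : ℝ} (hv : v ∈ Icc (0 : ℝ) 7) {s : ℝ} (hs : s ∈ Icc (b.tcLo - b.epsLo / 8) (b.tcLo + b.epsLo / 8)) :
    b.alphaLo κ s ≤ v ↔ s ≤ P.paramLo hv := by
  have hm := b.strictMonoOn_alphaLo (κ := κ) P.HU.cone.spike.κ_pos
  have key := hm.le_iff_le hs (P.paramLo_mem_core hv)
  rw [(P.paramLo_spec hv).2] at key
  exact key

/-- Comparison on the lower core, strict. [folklore] -/
theorem alphaLo_lt_iff {v : ℝ} (hv : v ∈ Icc (0 : ℝ) 7) {s : ℝ} (hs : s ∈ Icc (b.tcLo - b.epsLo / 8) (b.tcLo + b.epsLo / 8)) :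
    b.alphaLo κ s < v ↔ s < P.paramLo hv := by
  have hm := b.strictMonoOn_alphaLo (κ := κ) P.HU.cone.spike.κ_pos
  have key := hm.lt_iff_lt hs (P.paramLo_mem_core hv)
  rw [(P.paramLo_spec hv).2] at key
  exact key

/-- **Comparison on the upper core**: `αHi s ≤ v ↔ paramHi v ≤ s`. [folklore] -/
theorem alphaHi_le_iff {v : ℝ} (hv : v ∈ Icc (0 : ℝ) 7) {s : ℝ} (hs : s ∈ Icc (b.tcHi - b.epsHi / 8) (b.tcHi + b.epsHi / 8)) :
    b.alphaHi κ s ≤ v ↔ P.paramHi hv ≤ s := by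
  have hm := b.strictAntiOn_alphaHi (κ := κ) P.HU.cone.spike.κ_pos
  have key := hm.le_iff_ge hs (P.paramHi_mem_core hv)
  rw [(P.paramHi_spec hv).2] at key
  exact key

/-- Comparison on the upper core, strict. [folklore] -/
theorem alphaHi_lt_iff {v : ℝ} (hv : v ∈ Icc (0 : ℝ) 7) {s : ℝ} (hs : s ∈ Icc (b.tcHi - b.epsHi / 8) (b.tcHi + b.epsHi / 8)) :
    b.alphaHi κ s < v ↔ P.paramHi hv < s := by
  have hm := b.strictAntiOn_alphaHi (κ := κ) P.HU.cone.spike.κ_pos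
  have key := hm.lt_iff_gt hs (P.paramHi_mem_core hv)
  rw [(P.paramHi_spec hv).2] at key
  exact key

/-! ### Zone formulas for the track -/

/-- On the lower core with `αLo < 3/8` the parameter is not content. [folklore] -/
theorem not_mem_contentSet_of_alphaLo_lt {s : ℝ} (hs : s ∈ Icc (b.tcLo - b.epsLo / 8) (b.tcLo + b.epsLo / 8))
    (hα : b.alphaLo κ s < 3 / 8) : s ∉ b.contentSet P.HU.cone.spike.κ_pos P.HU.cone.spike.seven_le_gapLo P.HU.cone.spike.seven_le_gapHi := by
  intro hc
  have hj := b.juncLo_spec P.HU.cone.spike.κ_pos P.HU.cone.spike.seven_le_gapLo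
  have hjm := b.juncLo_mem_core P.HU.cone.spike.κ_pos P.HU.cone.spike.seven_le_gapLo
  have hle : b.juncLo P.HU.cone.spike.κ_pos P.HU.cone.spike.seven_le_gapLo ≤ s := hc.1
  have hm := b.strictMonoOn_alphaLo (κ := κ) P.HU.cone.spike.κ_pos
  have := (hm.le_iff_le hjm hs).2 hle
  rw [hj.2] at this; linarith

/-- On the upper core with `αHi < 3/8` the parameter is not content. [folklore] -/
theorem not_mem_contentSet_of_alphaHi_lt {s : ℝ} (hs : s ∈ Icc (b.tcHi - b.epsHi / 8) (b.tcHi + b.epsHi / 8))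
    (hα : b.alphaHi κ s < 3 / 8) : s ∉ b.contentSet P.HU.cone.spike.κ_pos P.HU.cone.spike.seven_le_gapLo P.HU.cone.spike.seven_le_gapHi := by
  intro hc
  have hj := b.juncHi_spec P.HU.cone.spike.κ_pos P.HU.cone.spike.seven_le_gapHi
  have hjm := b.juncHi_mem_core P.HU.cone.spike.κ_pos P.HU.cone.spike.seven_le_gapHi
  have hle : s ≤ b.juncHi P.HU.cone.spike.κ_pos P.HU.cone.spike.seven_le_gapHi := hc.2
  have hm := b.strictAntiOn_alphaHi (κ := κ) P.HU.cone.spike.κ_pos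
  have := (hm.le_iff_ge hjm hs).2 hle
  rw [hj.2] at this; linarith

/-- Left of the lower collar the host point is the bent knot point. [folklore] -/
theorem coe_hostPt_of_le_collarLo {s : ℝ} (hsI : s ∈ Ico b.alo (b.alo + 1)) (hs : s ≤ b.collarLo P.HU P.hl) :
    ((P.hostPt s : 𝕊 3) : 𝔼 4) = ((b.bentKnot P.HU P.hW P.hl P.hrA P.hB P.hAB (circlePt s) : 𝕊 3) : 𝔼 4) := by
  rw [P.coe_hostPt, b.hostLoop_of_not_mem_collar P.HU P.hl P.hl2 P.hW P.hrA P.hrA8 P.hB P.hAB hsI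
    (fun h ↦ absurd h.1 (not_lt.2 hs)), Knot.curve_apply]

/-- Right of the upper collar the host point is the bent knot point. [folklore] -/
theorem coe_hostPt_of_collarHi_le {s : ℝ} (hsI : s ∈ Ico b.alo (b.alo + 1)) (hs : b.collarHi P.HU P.hl ≤ s) :
    ((P.hostPt s : 𝕊 3) : 𝔼 4) = ((b.bentKnot P.HU P.hW P.hl P.hrA P.hB P.hAB (circlePt s) : 𝕊 3) : 𝔼 4) := by
  rw [P.coe_hostPt, b.hostLoop_of_not_mem_collar P.HU P.hl P.hl2 P.hW P.hrA P.hrA8 P.hB P.hAB hsI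
    (fun h ↦ absurd h.2 (not_lt.2 hs)), Knot.curve_apply]

/-- The lower collar point has `3/8 < αLo < 3/4`. [folklore] -/
theorem alphaLo_collarLo_mem : b.alphaLo κ (b.collarLo P.HU P.hl) ∈ Ioo (3 / 8 : ℝ) (3 / 4) :=
  b.alphaLo_clockLo_mem P.HU P.hl P.hl2 three_eighths_mem_Icc

/-- The upper collar point has `3/8 < αHi < 3/4`. [folklore] -/
theorem alphaHi_collarHi_mem : b.alphaHi κ (b.collarHi P.HU P.hl) ∈ Ioo (3 / 8 : ℝ) (3 / 4) :=
  b.alphaHi_clockHi_mem P.HU P.hl P.hl2 three_eighths_mem_Icc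

/-- **The track on the lower core with `αLo < 3/8` in the flat regime** `κ (|αLo| + 1) < r`: the
blow-up of the spiked lower piece. [folklore] -/
theorem trk_coreLo_flat {s : ℝ} (hs : s ∈ Icc (b.tcLo - b.epsLo / 8) (b.tcLo + b.epsLo / 8)) (hα : b.alphaLo κ s < 3 / 8)
    (hq : κ * (|b.alphaLo κ s| + 1) < r) :
    P.trk s = (1 - spikeBump (b.alphaLo κ s)) • b.blowUp hcross κ (b.railLoPsi κ (b.alphaLo κ s)) +
      spikeBump (b.alphaLo κ s) • modelLo b.depthSign (b.alphaLo κ s) := by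
  have h := P.HU.cone
  have hκ := h.spike.κ_pos
  have hsI : s ∈ Ico b.alo (b.alo + 1) := Ioo_subset_Ico_self (coreLo_subset hs)
  have hsc : s ≤ b.collarLo P.HU P.hl := by
    have hm := b.strictMonoOn_alphaLo (κ := κ) hκ
    have := hm.le_iff_le hs (b.collarLo_mem_core P.HU P.hl)
    rw [← this]; linarith [P.alphaLo_collarLo_mem.1]
  have hpt : ((P.hostPt s : 𝕊 3) : 𝔼 4) = ((psiN.symm (b.pieceLo hcross κ b.depthSign 1 (b.alphaLo κ s)) : 𝕊 3) : 𝔼 4) := by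
    rw [P.coe_hostPt_of_le_collarLo hsI hsc,
      b.bentKnot_circlePt_of_not_mem P.HU P.hW (b.isBendClear_spikePiece h) P.hA P.hl P.hrA P.hB P.hAB hsI
        (P.not_mem_contentSet_of_alphaLo_lt hs hα),
      b.spikePiece_one_coreLo h.spike hs (norm_railLoParam_lt hκ hq)]
  rw [trk, Subtype.ext hpt, psiN_apply_psiN_symm, b.blowUp_pieceLo hcross hκ.ne']
  simp

/-- The flat regime from a bound `|αLo| ≤ A'`. [folklore] -/
theorem scale_lt_of_abs_le {α : ℝ} (hα : |α| ≤ A') : κ * (|α| + 1) < r := by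
  have h := P.HU.cone.spike
  exact lt_of_le_of_lt (mul_le_mul_of_nonneg_left (by linarith) h.κ_pos.le) h.scale_lt_r

/-- **The track on the lower core with `-7 < αLo < 3/8`**: the blow-up of the spiked lower piece.
[folklore] -/
theorem trk_coreLo_of_lt {s : ℝ} (hs : s ∈ Icc (b.tcLo - b.epsLo / 8) (b.tcLo + b.epsLo / 8)) (hα : b.alphaLo κ s < 3 / 8)
    (hα' : -7 < b.alphaLo κ s) :
    P.trk s = (1 - spikeBump (b.alphaLo κ s)) • b.blowUp hcross κ (b.railLoPsi κ (b.alphaLo κ s)) +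
      spikeBump (b.alphaLo κ s) • modelLo b.depthSign (b.alphaLo κ s) :=
  P.trk_coreLo_flat hs hα (P.scale_lt_of_abs_le (by rw [abs_le]; constructor <;> linarith [P.HU.cone.spike.seven_le]))

/-- **The track on the lower core between the base and the lower collar**: the lower-line point
`O - ψLo dLo`. [folklore] -/
theorem trk_lower {s : ℝ} (hs : s ∈ Icc (b.tcLo - b.epsLo / 8) (b.tcLo + b.epsLo / 8))
    (hα : b.alphaLo κ s ∈ Icc (1 / 4 : ℝ) (3 / 4)) (hsc : s ≤ b.collarLo P.HU P.hl) :
    P.trk s = lowerPt b.depthSign (-b.psiLo κ lam₀ s) := by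
  have h := P.HU.cone
  have hκ := h.spike.κ_pos
  have hsI : s ∈ Ico b.alo (b.alo + 1) := Ioo_subset_Ico_self (coreLo_subset hs)
  by_cases h38 : b.alphaLo κ s < 3 / 8
  · -- the stub: a wall, read through the spiked lower piece
    rw [P.trk_coreLo_of_lt hs h38 (by linarith [hα.1]), spikeBump_eq_one ⟨hα.1, by linarith⟩,
      modelLo_of_le (by linarith), sub_self, zero_smul, zero_add, one_smul, lineLo_eq_lowerPt]
    congr 1
    simp only [psiLo, spikeScalar, spikeWin_eq_zero (show b.alphaLo κ s ≤ 7 / 16 by linarith)]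
    ring
  · push Not at h38
    apply P.trk_eq_of_coe_eq
    rw [P.coe_hostPt_of_le_collarLo hsI hsc, b.bentKnot_circlePt_lowerSpike P.HU P.hW P.hl P.hrA P.hB P.hAB hs ⟨h38, hα.2⟩,
      oS, b.blowDown_add_smul_sub hcross, pt3_add_smul_base_sub]
    rfl

/-- **The track on the window**: the straight piece `O + clockFn dLo`. [folklore] -/
theorem trk_window {s : ℝ} (hs : s ∈ Icc (b.winLo P.HU P.hl) (b.winHi P.HU P.hl)) :
    P.trk s = lowerPt b.depthSign (b.clockFn P.HU P.hl P.hl2 s) := by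
  apply P.trk_eq_of_coe_eq
  rw [P.coe_hostPt, b.hostLoop_of_mem_window P.HU P.hl P.hl2 P.hW P.hrA P.hrA8 P.hB P.hAB hs]
  rfl

/-- **The track on the upper core with `αHi < 3/8` in the flat regime.** [folklore] -/
theorem trk_coreHi_flat {s : ℝ} (hs : s ∈ Icc (b.tcHi - b.epsHi / 8) (b.tcHi + b.epsHi / 8)) (hα : b.alphaHi κ s < 3 / 8)
    (hq : κ * (|b.alphaHi κ s| + 1) < r) :
    P.trk s = (1 - spikeBump (b.alphaHi κ s)) • b.blowUp hcross κ (b.railHiPsi κ (b.alphaHi κ s)) +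
      spikeBump (b.alphaHi κ s) • modelHi b.depthSign (b.alphaHi κ s) := by
  have h := P.HU.cone
  have hκ := h.spike.κ_pos
  have hsI : s ∈ Ico b.alo (b.alo + 1) := Ioo_subset_Ico_self (coreHi_subset hs)
  have hsc : b.collarHi P.HU P.hl ≤ s := by
    have hm := b.strictAntiOn_alphaHi (κ := κ) hκ
    have := hm.le_iff_ge hs (b.collarHi_mem_core P.HU P.hl)
    rw [← this]; linarith [P.alphaHi_collarHi_mem.1]
  have hpt : ((P.hostPt s : 𝕊 3) : 𝔼 4) = ((psiN.symm (b.pieceHi hcross κ b.depthSign 1 (b.alphaHi κ s)) : 𝕊 3) : 𝔼 4) := by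
    rw [P.coe_hostPt_of_collarHi_le hsI hsc,
      b.bentKnot_circlePt_of_not_mem P.HU P.hW (b.isBendClear_spikePiece h) P.hA P.hl P.hrA P.hB P.hAB hsI
        (P.not_mem_contentSet_of_alphaHi_lt hs hα),
      b.spikePiece_one_coreHi h.spike hs (norm_railHiParam_lt hκ hq)]
  rw [trk, Subtype.ext hpt, psiN_apply_psiN_symm, b.blowUp_pieceHi hcross hκ.ne']
  simp

/-- **The track on the upper core with `-7 < αHi < 3/8`**: the blow-up of the spiked upper piece. [folklore] -/
theorem trk_coreHi_of_lt {s : ℝ} (hs : s ∈ Icc (b.tcHi - b.epsHi / 8) (b.tcHi + b.epsHi / 8)) (hα : b.alphaHi κ s < 3 / 8)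
    (hα' : -7 < b.alphaHi κ s) :
    P.trk s = (1 - spikeBump (b.alphaHi κ s)) • b.blowUp hcross κ (b.railHiPsi κ (b.alphaHi κ s)) +
      spikeBump (b.alphaHi κ s) • modelHi b.depthSign (b.alphaHi κ s) :=
  P.trk_coreHi_flat hs hα (P.scale_lt_of_abs_le (by rw [abs_le]; constructor <;> linarith [P.HU.cone.spike.seven_le]))

/-- **The track on the upper core between the upper collar and the base**: the bent point
`bendArc σ r_A ψHi 1`. [folklore] -/
theorem trk_upper {s : ℝ} (hs : s ∈ Icc (b.tcHi - b.epsHi / 8) (b.tcHi + b.epsHi / 8))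
    (hα : b.alphaHi κ s ∈ Icc (1 / 4 : ℝ) (3 / 4)) (hsc : b.collarHi P.HU P.hl ≤ s) :
    P.trk s = genPt b.depthSign rA (b.psiHi κ lam₀ s) := by
  have h := P.HU.cone
  have hκ := h.spike.κ_pos
  have hsI : s ∈ Ico b.alo (b.alo + 1) := Ioo_subset_Ico_self (coreHi_subset hs)
  by_cases h38 : b.alphaHi κ s < 3 / 8
  · have hψ : b.psiHi κ lam₀ s = 1 - (b.alphaHi κ s - 1 / 4) / (3 / 4) := by
      simp only [psiHi, spikeScalar, spikeWin_eq_zero (show b.alphaHi κ s ≤ 7 / 16 by linarith)]; ring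
    have hψ1 : 9 / 16 ≤ b.psiHi κ lam₀ s ^ 2 := by rw [hψ]; nlinarith [hα.1, h38]
    rw [P.trk_coreHi_of_lt hs h38 (by linarith [hα.1]), spikeBump_eq_one ⟨hα.1, by linarith⟩,
      modelHi_of_le (by linarith), sub_self, zero_smul, zero_add, one_smul, lineHi_eq_cO_add, genPt,
      bendArc_of_eq_zero b.depthSign (annulusCut_of_ge hψ1), hψ]
  · push Not at h38
    apply P.trk_eq_of_coe_eq
    rw [P.coe_hostPt_of_collarHi_le hsI hsc, b.bentKnot_circlePt_upperSpike P.HU P.hW P.hl P.hrA P.hB P.hAB hs ⟨h38, hα.2⟩]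
    rfl

/-! ### Neighbourhood versions of the zone formulas -/

/-- Near a parameter of the open lower core with `-7 < αLo < 3/8` the track is the blow-up of the
spiked lower piece (a `C^∞` expression). [folklore] -/
theorem trk_eventuallyEq_coreLo {s : ℝ} (hs : s ∈ Ioo (b.tcLo - b.epsLo / 8) (b.tcLo + b.epsLo / 8))
    (hα : b.alphaLo κ s < 3 / 8) (hα' : -7 < b.alphaLo κ s) :
    P.trk =ᶠ[𝓝 s] fun s ↦ (1 - spikeBump (b.alphaLo κ s)) • b.blowUp hcross κ (b.railLoPsi κ (b.alphaLo κ s)) +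
      spikeBump (b.alphaLo κ s) • modelLo b.depthSign (b.alphaLo κ s) := by
  have hc := (b.contDiff_alphaLo κ).continuous
  have h1 : ∀ᶠ s' in 𝓝 s, s' ∈ Ioo (b.tcLo - b.epsLo / 8) (b.tcLo + b.epsLo / 8) := isOpen_Ioo.mem_nhds hs
  have h2 : ∀ᶠ s' in 𝓝 s, b.alphaLo κ s' < 3 / 8 := hc.continuousAt.eventually (Iio_mem_nhds hα)
  have h3 : ∀ᶠ s' in 𝓝 s, -7 < b.alphaLo κ s' := hc.continuousAt.eventually (Ioi_mem_nhds hα')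
  filter_upwards [h1, h2, h3] with s' h1 h2 h3 using P.trk_coreLo_of_lt (Ioo_subset_Icc_self h1) h2 h3

/-- Near a parameter of the open upper core with `-7 < αHi < 3/8` the track is the blow-up of the
spiked upper piece. [folklore] -/
theorem trk_eventuallyEq_coreHi {s : ℝ} (hs : s ∈ Ioo (b.tcHi - b.epsHi / 8) (b.tcHi + b.epsHi / 8))
    (hα : b.alphaHi κ s < 3 / 8) (hα' : -7 < b.alphaHi κ s) :
    P.trk =ᶠ[𝓝 s] fun s ↦ (1 - spikeBump (b.alphaHi κ s)) • b.blowUp hcross κ (b.railHiPsi κ (b.alphaHi κ s)) +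
      spikeBump (b.alphaHi κ s) • modelHi b.depthSign (b.alphaHi κ s) := by
  have hc := (b.contDiff_alphaHi κ).continuous
  have h1 : ∀ᶠ s' in 𝓝 s, s' ∈ Ioo (b.tcHi - b.epsHi / 8) (b.tcHi + b.epsHi / 8) := isOpen_Ioo.mem_nhds hs
  have h2 : ∀ᶠ s' in 𝓝 s, b.alphaHi κ s' < 3 / 8 := hc.continuousAt.eventually (Iio_mem_nhds hα)
  have h3 : ∀ᶠ s' in 𝓝 s, -7 < b.alphaHi κ s' := hc.continuousAt.eventually (Ioi_mem_nhds hα')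
  filter_upwards [h1, h2, h3] with s' h1 h2 h3 using P.trk_coreHi_of_lt (Ioo_subset_Icc_self h1) h2 h3

/-- Near a parameter left of the lower collar with `1/4 < αLo < 3/4` the track is the lower-line
point. [folklore] -/
theorem trk_eventuallyEq_lower {s : ℝ} (hs : s ∈ Ioo (b.tcLo - b.epsLo / 8) (b.tcLo + b.epsLo / 8))
    (hα : b.alphaLo κ s ∈ Ioo (1 / 4 : ℝ) (3 / 4)) (hsc : s < b.collarLo P.HU P.hl) :
    P.trk =ᶠ[𝓝 s] fun s ↦ lowerPt b.depthSign (-b.psiLo κ lam₀ s) := by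
  have hc := (b.contDiff_alphaLo κ).continuous
  have h1 : ∀ᶠ s' in 𝓝 s, s' ∈ Ioo (b.tcLo - b.epsLo / 8) (b.tcLo + b.epsLo / 8) := isOpen_Ioo.mem_nhds hs
  have h2 : ∀ᶠ s' in 𝓝 s, b.alphaLo κ s' ∈ Ioo (1 / 4 : ℝ) (3 / 4) := hc.continuousAt.eventually (isOpen_Ioo.mem_nhds hα)
  have h3 : ∀ᶠ s' in 𝓝 s, s' < b.collarLo P.HU P.hl := Iio_mem_nhds hsc
  filter_upwards [h1, h2, h3] with s' h1 h2 h3 using P.trk_lower (Ioo_subset_Icc_self h1) (Ioo_subset_Icc_self h2) h3.le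

/-- Near a parameter right of the upper collar with `1/4 < αHi < 3/4` the track is the bent upper
point. [folklore] -/
theorem trk_eventuallyEq_upper {s : ℝ} (hs : s ∈ Ioo (b.tcHi - b.epsHi / 8) (b.tcHi + b.epsHi / 8))
    (hα : b.alphaHi κ s ∈ Ioo (1 / 4 : ℝ) (3 / 4)) (hsc : b.collarHi P.HU P.hl < s) :
    P.trk =ᶠ[𝓝 s] fun s ↦ genPt b.depthSign rA (b.psiHi κ lam₀ s) := by
  have hc := (b.contDiff_alphaHi κ).continuous
  have h1 : ∀ᶠ s' in 𝓝 s, s' ∈ Ioo (b.tcHi - b.epsHi / 8) (b.tcHi + b.epsHi / 8) := isOpen_Ioo.mem_nhds hs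
  have h2 : ∀ᶠ s' in 𝓝 s, b.alphaHi κ s' ∈ Ioo (1 / 4 : ℝ) (3 / 4) := hc.continuousAt.eventually (isOpen_Ioo.mem_nhds hα)
  have h3 : ∀ᶠ s' in 𝓝 s, b.collarHi P.HU P.hl < s' := Ioi_mem_nhds hsc
  filter_upwards [h1, h2, h3] with s' h1 h2 h3 using P.trk_upper (Ioo_subset_Icc_self h1) (Ioo_subset_Icc_self h2) h3.le

/-- Near a parameter of the open window the track is the straight piece. [folklore] -/
theorem trk_eventuallyEq_window {s : ℝ} (hs : s ∈ Ioo (b.winLo P.HU P.hl) (b.winHi P.HU P.hl)) :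
    P.trk =ᶠ[𝓝 s] fun s ↦ lowerPt b.depthSign (b.clockFn P.HU P.hl P.hl2 s) := by
  filter_upwards [isOpen_Ioo.mem_nhds hs] with s' hs' using P.trk_window (Ioo_subset_Icc_self hs')

/-! ### Order of the marks -/

omit P in
/-- `1/4 ∈ [0, 7]`. [folklore] -/
theorem quarter_mem07 : (1 / 4 : ℝ) ∈ Icc (0 : ℝ) 7 := by norm_num

omit P in
/-- `1/16 ∈ [0, 7]`. [folklore] -/
theorem sixteenth_mem07 : (1 / 16 : ℝ) ∈ Icc (0 : ℝ) 7 := by norm_num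

omit P in
/-- `5/16 ∈ [0, 7]`. [folklore] -/
theorem five16_mem07 : (5 / 16 : ℝ) ∈ Icc (0 : ℝ) 7 := by norm_num

omit P in
/-- `0 ∈ [0, 7]`. [folklore] -/
theorem zero_mem07 : (0 : ℝ) ∈ Icc (0 : ℝ) 7 := by norm_num

/-- The window lies strictly between the quarter marks: `paramLo (3/8) < winLo` ... precisely
`αLo (winLo) > 3/8`, so every lower-core parameter with `αLo ≤ 3/8` is left of `winLo`. [folklore] -/
theorem lt_winLo_of_alphaLo_le {s : ℝ} (hs : s ∈ Icc (b.tcLo - b.epsLo / 8) (b.tcLo + b.epsLo / 8))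
    (hα : b.alphaLo κ s ≤ 3 / 8) : s < b.winLo P.HU P.hl := by
  have hm := b.strictMonoOn_alphaLo (κ := κ) P.HU.cone.spike.κ_pos
  have hw := b.alphaLo_clockLo_mem P.HU P.hl P.hl2 half_mem_Icc
  by_contra hc; push Not at hc
  have := hm.le_iff_le (b.winLo_mem_core P.HU P.hl) hs |>.2 hc
  exact absurd (hw.1.trans_le this) (not_lt.2 hα)

/-- Every upper-core parameter with `αHi ≤ 3/8` is right of `winHi`. [folklore] -/
theorem winHi_lt_of_alphaHi_le {s : ℝ} (hs : s ∈ Icc (b.tcHi - b.epsHi / 8) (b.tcHi + b.epsHi / 8))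
    (hα : b.alphaHi κ s ≤ 3 / 8) : b.winHi P.HU P.hl < s := by
  have hm := b.strictAntiOn_alphaHi (κ := κ) P.HU.cone.spike.κ_pos
  have hw := b.alphaHi_clockHi_mem P.HU P.hl P.hl2 half_mem_Icc
  by_contra hc; push Not at hc
  have := (hm.le_iff_ge (b.winHi_mem_core P.HU P.hl) hs).2 hc
  exact absurd (hw.1.trans_le this) (not_lt.2 hα)

/-- The window marks in order, and the collars inside. [folklore] -/
theorem winLo_lt_collarLo : b.winLo P.HU P.hl < b.collarLo P.HU P.hl := b.winLo_lt_collarLo P.HU P.hl P.hl2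

/-- The window marks in order. [folklore] -/
theorem collarLo_lt_collarHi : b.collarLo P.HU P.hl < b.collarHi P.HU P.hl := b.collarLo_lt_collarHi P.HU P.hl P.hl2

/-- The window marks in order. [folklore] -/
theorem collarHi_lt_winHi : b.collarHi P.HU P.hl < b.winHi P.HU P.hl := b.collarHi_lt_winHi P.HU P.hl P.hl2

/-! ### The level along the track -/

/-- **The level along the track.** [folklore] -/
def mu (s : ℝ) : ℝ := lev (P.trk s)

/-- The upper ray scalar is at most `1` where `αHi ≥ 1/4`. [folklore] -/
theorem psiHi_le_one {s : ℝ} (hα : 1 / 4 ≤ b.alphaHi κ s) : b.psiHi κ lam₀ s ≤ 1 := by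
  have hl := P.hl
  have hw := smoothStep_mem_Icc (7 / 16) (11 / 16) (b.alphaHi κ s)
  change spikeWin (b.alphaHi κ s) ∈ Icc (0:ℝ) 1 at hw
  simp only [psiHi, spikeScalar]
  have h1 : 0 ≤ 1 - spikeWin (b.alphaHi κ s) * (1 * (1 - lam₀)) ∧ 1 - spikeWin (b.alphaHi κ s) * (1 * (1 - lam₀)) ≤ 1 :=
    ⟨by nlinarith [hw.1, hw.2, hl.1, hl.2], by nlinarith [hw.1, hw.2, hl.1, hl.2]⟩
  by_cases h : 1 - (b.alphaHi κ s - 1 / 4) / (3 / 4) ≤ 0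
  · nlinarith [h1.1]
  · push Not at h
    have h2 : 1 - (b.alphaHi κ s - 1 / 4) / (3 / 4) ≤ 1 := by linarith [div_nonneg (by linarith : 0 ≤ b.alphaHi κ s - 1 / 4) (by norm_num : (0:ℝ) ≤ 3 / 4)]
    nlinarith [h1.1, h1.2]

/-- The upper ray scalar exceeds `3/8` right of the upper collar (where `αHi ≥ 1/4`... and `< 1`). [folklore] -/
theorem lt_psiHi_of_collarHi_lt {s : ℝ} (hs : s ∈ Icc (b.tcHi - b.epsHi / 8) (b.tcHi + b.epsHi / 8))
    (hsc : b.collarHi P.HU P.hl < s) : 3 / 8 < b.psiHi κ lam₀ s := by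
  have hc := b.collarHi_mem_core P.HU P.hl
  have hsp := (b.clockHi_spec P.HU P.hl three_eighths_mem_Icc).2
  have hα1 : b.alphaHi κ (b.collarHi P.HU P.hl) < 1 := by linarith [P.alphaHi_collarHi_mem.2]
  have := b.psiHi_lt_psiHi P.HU P.hl hc hs hsc hα1
  rw [show b.clockHi P.HU P.hl three_eighths_mem_Icc = b.collarHi P.HU P.hl from rfl] at hsp
  linarith

/-- The lower ray scalar exceeds `3/8` left of the lower collar. [folklore] -/
theorem lt_psiLo_of_lt_collarLo {s : ℝ} (hs : s ∈ Icc (b.tcLo - b.epsLo / 8) (b.tcLo + b.epsLo / 8))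
    (hsc : s < b.collarLo P.HU P.hl) : 3 / 8 < b.psiLo κ lam₀ s := by
  have hc := b.collarLo_mem_core P.HU P.hl
  have hsp := (b.clockLo_spec P.HU P.hl three_eighths_mem_Icc).2
  have hα1 : b.alphaLo κ (b.collarLo P.HU P.hl) < 1 := by linarith [P.alphaLo_collarLo_mem.2]
  have := b.psiLo_lt_psiLo P.HU P.hl hs hc hsc hα1
  rw [show b.clockLo P.HU P.hl three_eighths_mem_Icc = b.collarLo P.HU P.hl from rfl] at hsp
  linarith

/-- `levGen` is differentiable beyond `2 r_A`. [folklore] -/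
theorem hasDerivAt_levGen {ψ : ℝ} (hψ : 2 * rA < ψ) : HasDerivAt (levGen rA) (deriv (levGen rA) ψ) ψ := by
  have hφd : HasDerivAt (bendAng rA) _ ψ := hasDerivAt_bendAng P.hrA hψ
  have hcos := (Real.hasDerivAt_cos _).comp ψ hφd
  have hsin := (Real.hasDerivAt_sin _).comp ψ hφd
  have h : HasDerivAt (levGen rA) _ ψ := ((hasDerivAt_id ψ).mul hcos).add (((hasDerivAt_id ψ).mul hsin).const_mul epsP)
  exact h.differentiableAt.hasDerivAt

/-- **The level has positive derivative strictly inside the excursion.** [folklore] -/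
theorem deriv_mu_pos {s : ℝ} (hs : s ∈ Ioo (P.paramLo quarter_mem07) (P.paramHi quarter_mem07)) : 0 < deriv P.mu s := by
  have hκ := P.HU.cone.spike.κ_pos
  have hε := epsP_pos
  have q : (1 / 4 : ℝ) ∈ Icc (0 : ℝ) 7 := quarter_mem07
  have hpL := P.paramLo_spec q; have hpLc := P.paramLo_mem_core q
  have hpH := P.paramHi_spec q; have hpHc := P.paramHi_mem_core q
  have hcLc := b.collarLo_mem_core P.HU P.hl; have hcHc := b.collarHi_mem_core P.HU P.hl
  have hwL := b.winLo_mem_core P.HU P.hl; have hwH := b.winHi_mem_core P.HU P.hl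
  by_cases h1 : s < b.collarLo P.HU P.hl
  · -- lower line: `mu = -ε_P ψLo`
    have hsc : s ∈ Icc (b.tcLo - b.epsLo / 8) (b.tcLo + b.epsLo / 8) := ⟨by linarith [hs.1, hpLc.1], by linarith [hcLc.2]⟩
    have hso : s ∈ Ioo (b.tcLo - b.epsLo / 8) (b.tcLo + b.epsLo / 8) := ⟨by linarith [hs.1, hpL.1.1, b.epsLo_bounds.1], by linarith [hcLc.2]⟩
    have hαgt : 1 / 4 < b.alphaLo κ s := by
      by_contra hc; push Not at hc
      exact absurd ((P.alphaLo_le_iff q hsc).1 hc) (not_le.2 hs.1)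
    have hαlt : b.alphaLo κ s < 3 / 4 := by
      have hm := b.strictMonoOn_alphaLo (κ := κ) hκ
      linarith [hm hsc hcLc h1, P.alphaLo_collarLo_mem.2]
    have hev : P.mu =ᶠ[𝓝 s] fun s ↦ -(epsP * b.psiLo κ lam₀ s) :=
      (P.trk_eventuallyEq_lower hso ⟨hαgt, hαlt⟩ h1).mono fun s' hs' ↦ by
        show lev (P.trk s') = _; rw [hs', lev_lowerPt]; ring
    rw [hev.deriv_eq]
    obtain ⟨D, hD, hDd⟩ := b.hasDerivAt_psiLo_neg P.hl hκ hsc (by linarith)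
    have hd : HasDerivAt (fun s ↦ -(epsP * b.psiLo κ lam₀ s)) (-(epsP * D)) s := (hDd.const_mul epsP).neg
    rw [hd.deriv]
    nlinarith
  by_cases h2 : b.collarHi P.HU P.hl < s
  · -- bent upper ray: `mu = levGen ∘ ψHi`
    push Not at h1
    have hsc : s ∈ Icc (b.tcHi - b.epsHi / 8) (b.tcHi + b.epsHi / 8) := ⟨by linarith [hcHc.1], by linarith [hs.2, hpHc.2]⟩
    have hso : s ∈ Ioo (b.tcHi - b.epsHi / 8) (b.tcHi + b.epsHi / 8) := ⟨by linarith [hcHc.1], by linarith [hs.2, hpH.1.2, b.epsHi_bounds.1]⟩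
    have hαgt : 1 / 4 < b.alphaHi κ s := by
      by_contra hc; push Not at hc
      exact absurd ((P.alphaHi_le_iff q hsc).1 hc) (not_le.2 hs.2)
    have hαlt : b.alphaHi κ s < 3 / 4 := by
      have hm := b.strictAntiOn_alphaHi (κ := κ) hκ
      linarith [hm hcHc hsc h2, P.alphaHi_collarHi_mem.2]
    have hev : P.mu =ᶠ[𝓝 s] fun s ↦ levGen rA (b.psiHi κ lam₀ s) :=
      (P.trk_eventuallyEq_upper hso ⟨hαgt, hαlt⟩ h2).mono fun s' hs' ↦ by
        show lev (P.trk s') = _; rw [hs', lev_genPt]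
    rw [hev.deriv_eq]
    obtain ⟨D, hD, hDd⟩ := b.hasDerivAt_psiHi_pos P.hl hκ hsc (by linarith)
    have hψ : 2 * rA < b.psiHi κ lam₀ s := by linarith [P.lt_psiHi_of_collarHi_lt hsc h2, P.hrA8]
    have hL := P.hasDerivAt_levGen hψ
    have hd : HasDerivAt (fun s ↦ levGen rA (b.psiHi κ lam₀ s)) (deriv (levGen rA) (b.psiHi κ lam₀ s) * D) s := hL.comp s hDd
    rw [hd.deriv]
    exact mul_pos (deriv_levGen_pos P.hrA hψ (P.psiHi_le_one hαgt.le)) hD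
  · -- the window: `mu = ε_P clockFn`
    push Not at h1 h2
    have hsw : s ∈ Ioo (b.winLo P.HU P.hl) (b.winHi P.HU P.hl) := ⟨by linarith [P.winLo_lt_collarLo], by linarith [P.collarHi_lt_winHi]⟩
    have hev : P.mu =ᶠ[𝓝 s] fun s ↦ epsP * b.clockFn P.HU P.hl P.hl2 s :=
      (P.trk_eventuallyEq_window hsw).mono fun s' hs' ↦ by show lev (P.trk s') = _; rw [hs', lev_lowerPt]
    rw [hev.deriv_eq]
    have hc := ((b.contDiff_clockFn P.HU P.hl P.hl2).differentiable (by simp) s).hasDerivAt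
    rw [(hc.const_mul epsP).deriv]
    exact mul_pos hε (b.deriv_clockFn_pos P.HU P.hl P.hl2 (Ioo_subset_Icc_self hsw))

/-! ### Smoothness of the track and the host point in the chart -/

/-- `α ↦ blowUp (railLoPsi κ α)` is `C^∞` at `|α| ≤ A'`. [folklore] -/
theorem contDiffAt_blowUp_railLoPsi {α : ℝ} (hα : |α| ≤ A') :
    ContDiffAt ℝ ∞ (fun a ↦ b.blowUp hcross κ (b.railLoPsi κ a)) α := by
  have h := P.HU.cone.spike
  have hq : ‖(pt2 (κ * α) (-κ) : 𝔼 2)‖ < b.poleRad hcross := by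
    refine (norm_railLoParam_lt h.κ_pos (lt_of_le_of_lt ?_ h.scale_lt_r)).trans_le h.flat.r_le
    exact mul_le_mul_of_nonneg_left (by linarith) h.κ_pos.le
  have hc : ContDiff ℝ ∞ (fun a : ℝ ↦ (pt2 (κ * a) (-κ) : 𝔼 2)) := by
    rw [contDiff_euclidean]; intro i; fin_cases i
    · exact contDiff_const.mul contDiff_id
    · exact contDiff_const
  exact (b.contDiff_blowUp hcross κ).contDiffAt.comp α ((b.contDiffAt_Fband hcross hq).comp α hc.contDiffAt)

/-- `α ↦ blowUp (railHiPsi κ α)` is `C^∞` at `|α| ≤ A'`. [folklore] -/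
theorem contDiffAt_blowUp_railHiPsi {α : ℝ} (hα : |α| ≤ A') :
    ContDiffAt ℝ ∞ (fun a ↦ b.blowUp hcross κ (b.railHiPsi κ a)) α := by
  have h := P.HU.cone.spike
  have hq : ‖(pt2 (κ * α) κ : 𝔼 2)‖ < b.poleRad hcross := by
    refine (norm_railHiParam_lt h.κ_pos (lt_of_le_of_lt ?_ h.scale_lt_r)).trans_le h.flat.r_le
    exact mul_le_mul_of_nonneg_left (by linarith) h.κ_pos.le
  have hc : ContDiff ℝ ∞ (fun a : ℝ ↦ (pt2 (κ * a) κ : 𝔼 2)) := by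
    rw [contDiff_euclidean]; intro i; fin_cases i
    · exact contDiff_const.mul contDiff_id
    · exact contDiff_const
  exact (b.contDiff_blowUp hcross κ).contDiffAt.comp α ((b.contDiffAt_Fband hcross hq).comp α hc.contDiffAt)

omit P in
/-- The lower line is affine, hence `C^∞` in the clock. [folklore] -/
theorem contDiff_lowerPt (σ : ℝ) : ContDiff ℝ ∞ (lowerPt σ) :=
  contDiff_const.add (contDiff_id.smul contDiff_const)

omit P in
/-- The bent upper point is `C^∞` in `ψ`. [folklore] -/
theorem contDiff_genPt (σ rA' : ℝ) : ContDiff ℝ ∞ (genPt σ rA') := by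
  have hA : ContDiff ℝ ∞ fun ψ : ℝ ↦ annulusCut rA' (ψ ^ 2) :=
    ((contDiff_smoothStep _ _).mul (contDiff_const.sub (contDiff_smoothStep _ _))).comp (contDiff_id.pow 2)
  have hφ : ContDiff ℝ ∞ fun ψ : ℝ ↦ π / 2 * annulusCut rA' (ψ ^ 2) * 1 := (contDiff_const.mul hA).mul contDiff_const
  unfold genPt bendArc
  exact (contDiff_const.add ((contDiff_id.mul (Real.contDiff_sin.comp hφ)).smul contDiff_const)).add
    ((contDiff_id.mul (Real.contDiff_cos.comp hφ)).smul contDiff_const)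

/-- **The track is `C^∞` on the moving region** `[paramLo 0, paramHi 0]`. [folklore] -/
theorem contDiffAt_trk {s : ℝ} (hs : s ∈ Icc (P.paramLo zero_mem07) (P.paramHi zero_mem07)) : ContDiffAt ℝ ∞ P.trk s := by
  have hκ := P.HU.cone.spike.κ_pos
  have h7 := P.HU.cone.spike.seven_le
  have hp0 := P.paramLo_spec zero_mem07; have hp0c := P.paramLo_mem_core zero_mem07
  have hq0 := P.paramHi_spec zero_mem07; have hq0c := P.paramHi_mem_core zero_mem07
  have hcLc := b.collarLo_mem_core P.HU P.hl; have hcHc := b.collarHi_mem_core P.HU P.hl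
  by_cases h1 : s < b.collarLo P.HU P.hl
  · have hsc : s ∈ Icc (b.tcLo - b.epsLo / 8) (b.tcLo + b.epsLo / 8) := ⟨by linarith [hs.1, hp0c.1], by linarith [hcLc.2]⟩
    have hso : s ∈ Ioo (b.tcLo - b.epsLo / 8) (b.tcLo + b.epsLo / 8) := ⟨by linarith [hs.1, hp0.1.1, b.epsLo_bounds.1], by linarith [hcLc.2]⟩
    have hα0 : 0 ≤ b.alphaLo κ s := by
      rw [← hp0.2]; exact (b.strictMonoOn_alphaLo (κ := κ) hκ).monotoneOn hp0c hsc hs.1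
    by_cases h38 : b.alphaLo κ s < 3 / 8
    · refine ContDiffAt.congr_of_eventuallyEq ?_ (P.trk_eventuallyEq_coreLo hso h38 (by linarith))
      have hA : ContDiffAt ℝ ∞ (b.alphaLo κ) s := (b.contDiff_alphaLo κ).contDiffAt
      have hB : ContDiffAt ℝ ∞ (fun s ↦ spikeBump (b.alphaLo κ s)) s := contDiff_spikeBump.contDiffAt.comp s hA
      have hR : ContDiffAt ℝ ∞ (fun s ↦ b.blowUp hcross κ (b.railLoPsi κ (b.alphaLo κ s))) s :=
        (P.contDiffAt_blowUp_railLoPsi (by rw [abs_le]; constructor <;> linarith)).comp s hA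
      have hM : ContDiffAt ℝ ∞ (fun s ↦ modelLo b.depthSign (b.alphaLo κ s)) s := (contDiff_modelLo _).contDiffAt.comp s hA
      exact ((contDiffAt_const.sub hB).smul hR).add (hB.smul hM)
    · push Not at h38
      have hαlt : b.alphaLo κ s < 3 / 4 := by
        have hm := b.strictMonoOn_alphaLo (κ := κ) hκ
        linarith [hm hsc hcLc h1, P.alphaLo_collarLo_mem.2]
      refine ContDiffAt.congr_of_eventuallyEq ?_ (P.trk_eventuallyEq_lower hso ⟨by linarith, hαlt⟩ h1)
      exact (contDiff_lowerPt _).contDiffAt.comp s (b.contDiff_psiLo κ lam₀).neg.contDiffAt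
  by_cases h2 : b.collarHi P.HU P.hl < s
  · push Not at h1
    have hsc : s ∈ Icc (b.tcHi - b.epsHi / 8) (b.tcHi + b.epsHi / 8) := ⟨by linarith [hcHc.1], by linarith [hs.2, hq0c.2]⟩
    have hso : s ∈ Ioo (b.tcHi - b.epsHi / 8) (b.tcHi + b.epsHi / 8) := ⟨by linarith [hcHc.1], by linarith [hs.2, hq0.1.2, b.epsHi_bounds.1]⟩
    have hα0 : 0 ≤ b.alphaHi κ s := by
      rw [← hq0.2]; exact (b.strictAntiOn_alphaHi (κ := κ) hκ).antitoneOn hsc hq0c hs.2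
    by_cases h38 : b.alphaHi κ s < 3 / 8
    · refine ContDiffAt.congr_of_eventuallyEq ?_ (P.trk_eventuallyEq_coreHi hso h38 (by linarith))
      have hA : ContDiffAt ℝ ∞ (b.alphaHi κ) s := (b.contDiff_alphaHi κ).contDiffAt
      have hB : ContDiffAt ℝ ∞ (fun s ↦ spikeBump (b.alphaHi κ s)) s := contDiff_spikeBump.contDiffAt.comp s hA
      have hR : ContDiffAt ℝ ∞ (fun s ↦ b.blowUp hcross κ (b.railHiPsi κ (b.alphaHi κ s))) s :=
        (P.contDiffAt_blowUp_railHiPsi (by rw [abs_le]; constructor <;> linarith)).comp s hA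
      have hM : ContDiffAt ℝ ∞ (fun s ↦ modelHi b.depthSign (b.alphaHi κ s)) s := (contDiff_modelHi _).contDiffAt.comp s hA
      exact ((contDiffAt_const.sub hB).smul hR).add (hB.smul hM)
    · push Not at h38
      have hαlt : b.alphaHi κ s < 3 / 4 := by
        have hm := b.strictAntiOn_alphaHi (κ := κ) hκ
        linarith [hm hcHc hsc h2, P.alphaHi_collarHi_mem.2]
      refine ContDiffAt.congr_of_eventuallyEq ?_ (P.trk_eventuallyEq_upper hso ⟨by linarith, hαlt⟩ h2)
      exact (contDiff_genPt _ _).contDiffAt.comp s (b.contDiff_psiHi κ lam₀).contDiffAt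
  · push Not at h1 h2
    have hsw : s ∈ Ioo (b.winLo P.HU P.hl) (b.winHi P.HU P.hl) := ⟨by linarith [P.winLo_lt_collarLo], by linarith [P.collarHi_lt_winHi]⟩
    refine ContDiffAt.congr_of_eventuallyEq ?_ (P.trk_eventuallyEq_window hsw)
    exact (contDiff_lowerPt _).contDiffAt.comp s (b.contDiff_clockFn P.HU P.hl P.hl2).contDiffAt

/-- **On the moving region the host point is read back from its track**:
`host = ψ⁻¹ (blowDown (trk))`. [folklore] -/
theorem coe_hostPt_eq {s : ℝ} (hs : s ∈ Icc (P.paramLo zero_mem07) (P.paramHi zero_mem07)) :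
    ((P.hostPt s : 𝕊 3) : 𝔼 4) = ((psiN.symm (b.blowDown hcross κ (P.trk s)) : 𝕊 3) : 𝔼 4) := by
  have hκ := P.HU.cone.spike.κ_pos
  have h := P.HU.cone
  -- it suffices that the host point is not the north pole
  suffices hne : P.hostPt s ≠ northPole by
    rw [trk, b.blowDown_blowUp hcross hκ.ne', psiN_symm_apply_psiN hne]
  have hp0 := P.paramLo_spec zero_mem07; have hp0c := P.paramLo_mem_core zero_mem07
  have hq0 := P.paramHi_spec zero_mem07; have hq0c := P.paramHi_mem_core zero_mem07
  have hcLc := b.collarLo_mem_core P.HU P.hl; have hcHc := b.collarHi_mem_core P.HU P.hl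
  have key : ∀ {y : 𝔼 3}, ((P.hostPt s : 𝕊 3) : 𝔼 4) = ((psiN.symm y : 𝕊 3) : 𝔼 4) → P.hostPt s ≠ northPole :=
    fun {y} he ↦ by rw [Subtype.ext he]; exact psiN_symm_ne_northPole _
  by_cases h1 : s ≤ b.collarLo P.HU P.hl
  · have hsc : s ∈ Icc (b.tcLo - b.epsLo / 8) (b.tcLo + b.epsLo / 8) := ⟨by linarith [hs.1, hp0c.1], by linarith [hcLc.2]⟩
    have hsI : s ∈ Ico b.alo (b.alo + 1) := Ioo_subset_Ico_self (coreLo_subset hsc)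
    have hα0 : 0 ≤ b.alphaLo κ s := by
      rw [← hp0.2]; exact (b.strictMonoOn_alphaLo (κ := κ) hκ).monotoneOn hp0c hsc hs.1
    by_cases h38 : b.alphaLo κ s < 3 / 8
    · have hA7 : |b.alphaLo κ s| ≤ A' := by rw [abs_le]; constructor <;> linarith [h.spike.seven_le]
      apply key
      rw [P.coe_hostPt_of_le_collarLo hsI h1,
        b.bentKnot_circlePt_of_not_mem P.HU P.hW (b.isBendClear_spikePiece h) P.hA P.hl P.hrA P.hB P.hAB hsI
          (P.not_mem_contentSet_of_alphaLo_lt hsc h38),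
        b.spikePiece_one_coreLo h.spike hsc (P.railLoParam_lt hA7)]
    · push Not at h38
      have hαlt : b.alphaLo κ s ≤ 3 / 4 := by
        have hm := b.strictMonoOn_alphaLo (κ := κ) hκ
        linarith [hm.monotoneOn hsc hcLc h1, P.alphaLo_collarLo_mem.2]
      apply key
      rw [P.coe_hostPt_of_le_collarLo hsI h1, b.bentKnot_circlePt_lowerSpike P.HU P.hW P.hl P.hrA P.hB P.hAB hsc ⟨h38, hαlt⟩]
  by_cases h2 : b.collarHi P.HU P.hl ≤ s
  · have hsc : s ∈ Icc (b.tcHi - b.epsHi / 8) (b.tcHi + b.epsHi / 8) := ⟨by linarith [hcHc.1], by linarith [hs.2, hq0c.2]⟩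
    have hsI : s ∈ Ico b.alo (b.alo + 1) := Ioo_subset_Ico_self (coreHi_subset hsc)
    have hα0 : 0 ≤ b.alphaHi κ s := by
      rw [← hq0.2]; exact (b.strictAntiOn_alphaHi (κ := κ) hκ).antitoneOn hsc hq0c hs.2
    by_cases h38 : b.alphaHi κ s < 3 / 8
    · have hA7 : |b.alphaHi κ s| ≤ A' := by rw [abs_le]; constructor <;> linarith [h.spike.seven_le]
      apply key
      rw [P.coe_hostPt_of_collarHi_le hsI h2,
        b.bentKnot_circlePt_of_not_mem P.HU P.hW (b.isBendClear_spikePiece h) P.hA P.hl P.hrA P.hB P.hAB hsI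
          (P.not_mem_contentSet_of_alphaHi_lt hsc h38),
        b.spikePiece_one_coreHi h.spike hsc (P.railHiParam_lt hA7)]
    · push Not at h38
      have hαlt : b.alphaHi κ s ≤ 3 / 4 := by
        have hm := b.strictAntiOn_alphaHi (κ := κ) hκ
        linarith [hm.antitoneOn hcHc hsc h2, P.alphaHi_collarHi_mem.2]
      apply key
      rw [P.coe_hostPt_of_collarHi_le hsI h2, b.bentKnot_circlePt_upperSpike P.HU P.hW P.hl P.hrA P.hB P.hAB hsc ⟨h38, hαlt⟩]
  · push Not at h1 h2
    have hsw : s ∈ Icc (b.winLo P.HU P.hl) (b.winHi P.HU P.hl) := ⟨by linarith [P.winLo_lt_collarLo], by linarith [P.collarHi_lt_winHi]⟩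
    apply key
    rw [P.coe_hostPt, b.hostLoop_of_mem_window P.HU P.hl P.hl2 P.hW P.hrA P.hrA8 P.hB P.hAB hsw]
    rfl

/-- **The level is strictly increasing on the closed excursion** `[paramLo (1/4), paramHi (1/4)]`.
[folklore] -/
theorem strictMonoOn_mu : StrictMonoOn P.mu (Icc (P.paramLo quarter_mem07) (P.paramHi quarter_mem07)) := by
  have h0 := P.paramLo_spec zero_mem07; have hq := P.paramLo_spec quarter_mem07
  have h0' := P.paramHi_spec zero_mem07; have hq' := P.paramHi_spec quarter_mem07
  have hκ := P.HU.cone.spike.κ_pos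
  have hle : P.paramLo zero_mem07 ≤ P.paramLo quarter_mem07 := by
    rw [← P.alphaLo_le_iff quarter_mem07 (P.paramLo_mem_core zero_mem07), h0.2]; norm_num
  have hle' : P.paramHi quarter_mem07 ≤ P.paramHi zero_mem07 := by
    rw [← P.alphaHi_le_iff quarter_mem07 (P.paramHi_mem_core zero_mem07), h0'.2]; norm_num
  refine strictMonoOn_of_deriv_pos (convex_Icc _ _) (fun s hs ↦ ?_) (fun s hs ↦ P.deriv_mu_pos ?_)
  · have hts := P.contDiffAt_trk ⟨hle.trans hs.1, hs.2.trans hle'⟩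
    have : ContDiffAt ℝ ∞ P.mu s := by
      have hl : ContDiff ℝ ∞ lev := by
        have e : lev = fun Y : 𝔼 3 ↦ (1 + epsP) / 2 * Y 1 - 2 / 3 * (1 - epsP) * (Y 0 - 1) := funext lev_eq
        rw [e]
        exact (contDiff_const.mul (contDiff_euclidean.1 contDiff_id 1)).sub
          (contDiff_const.mul ((contDiff_euclidean.1 contDiff_id 0).sub contDiff_const))
      exact hl.contDiffAt.comp s hts
    exact this.continuousAt.continuousWithinAt
  · rwa [interior_Icc] at hs

/-! ### The target planar curve -/

/-- **The blend cut** `wCut = smoothStep (1/4 + 1/48) (1/4 + 1/24)`. [folklore] -/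
def wCut (α : ℝ) : ℝ := smoothStep (1 / 4 + 1 / 48) (1 / 4 + 1 / 24) α

omit P in
/-- The blend cut is `C^∞`. [folklore] -/
theorem contDiff_wCut : ContDiff ℝ ∞ wCut := contDiff_smoothStep _ _

omit P in
/-- The blend cut takes values in `[0, 1]`. [folklore] -/
theorem wCut_mem (α : ℝ) : wCut α ∈ Icc (0 : ℝ) 1 := smoothStep_mem_Icc _ _ _

omit P in
/-- Left of `1/4 + 1/48` the blend cut vanishes. [folklore] -/
theorem wCut_of_le {α : ℝ} (h : α ≤ 1 / 4 + 1 / 48) : wCut α = 0 := smoothStep_of_le (by norm_num) h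

omit P in
/-- Right of `1/4 + 1/24` the blend cut is `1`. [folklore] -/
theorem wCut_of_ge {α : ℝ} (h : 1 / 4 + 1 / 24 ≤ α) : wCut α = 1 := smoothStep_of_ge (by norm_num) h

/-- **The target planar curve**: the hairpin `tgt ∘ mu`, blended to the lower rail line
`(αLo, -1)` and the upper rail line `(αHi, 1)` where the blown-up parameters are near `1/4`.
[folklore] -/
def hh (s : ℝ) : 𝔼 2 :=
  tgt (P.mu s) + (1 - wCut (b.alphaLo κ s)) • (pt2 (b.alphaLo κ s) (-1) - tgt (P.mu s)) +
    (1 - wCut (b.alphaHi κ s)) • (pt2 (b.alphaHi κ s) 1 - tgt (P.mu s))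

/-- On the lower core the upper blend cut is `1` (`αHi ≥ 6`). [folklore] -/
theorem wCut_alphaHi_of_coreLo {s : ℝ} (hs : s ≤ b.tcLo + b.epsLo / 8) : wCut (b.alphaHi κ s) = 1 := by
  have h := b.six_le_alphaHi_of_coreLo P.HU.cone (show s ≤ b.thi by linarith [b.tcLo_window.2.1, b.marks_lt.2.2.2.1, b.epsLo_bounds.1])
  exact wCut_of_ge (by linarith)

/-- On the upper core the lower blend cut is `1` (`αLo ≥ 6`). [folklore] -/
theorem wCut_alphaLo_of_coreHi {s : ℝ} (hs : b.tcHi - b.epsHi / 8 ≤ s) : wCut (b.alphaLo κ s) = 1 := by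
  have h := b.six_le_alphaLo_of_coreHi P.HU.cone (show b.tlo ≤ s by linarith [b.tcHi_window.1, b.marks_lt.2.2.2.1, b.epsHi_bounds.1])
  exact wCut_of_ge (by linarith)

/-- **The target on the lower bridge side** (`αLo ≤ 1/4 + 1/48`, lower core): the rail line point
`(αLo, -1)`. [folklore] -/
theorem hh_of_alphaLo_le {s : ℝ} (hs : s ≤ b.tcLo + b.epsLo / 8) (hα : b.alphaLo κ s ≤ 1 / 4 + 1 / 48) :
    P.hh s = pt2 (b.alphaLo κ s) (-1) := by
  rw [hh, wCut_of_le hα, P.wCut_alphaHi_of_coreLo hs]; simp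

/-- **The target on the upper bridge side**: the rail line point `(αHi, 1)`. [folklore] -/
theorem hh_of_alphaHi_le {s : ℝ} (hs : b.tcHi - b.epsHi / 8 ≤ s) (hα : b.alphaHi κ s ≤ 1 / 4 + 1 / 48) :
    P.hh s = pt2 (b.alphaHi κ s) 1 := by
  rw [hh, wCut_of_le hα, P.wCut_alphaLo_of_coreHi hs]; simp

/-- **The target in the middle** (`αLo, αHi ≥ 1/4 + 1/24`): the hairpin `tgt (mu s)`. [folklore] -/
theorem hh_of_ge {s : ℝ} (h1 : 1 / 4 + 1 / 24 ≤ b.alphaLo κ s) (h2 : 1 / 4 + 1 / 24 ≤ b.alphaHi κ s) :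
    P.hh s = tgt (P.mu s) := by
  rw [hh, wCut_of_ge h1, wCut_of_ge h2]; simp

/-- The level on the lower stub (`αLo ∈ [1/4, 3/8]`, lower core): `ε_P (-1 + (4/3)(αLo - 1/4))`. [folklore] -/
theorem mu_stubLo {s : ℝ} (hs : s ∈ Icc (b.tcLo - b.epsLo / 8) (b.tcLo + b.epsLo / 8)) (hα : b.alphaLo κ s ∈ Icc (1 / 4 : ℝ) (3 / 8)) :
    P.mu s = epsP * (-1 + 4 / 3 * (b.alphaLo κ s - 1 / 4)) := by
  have hsc : s ≤ b.collarLo P.HU P.hl := by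
    have hm := b.strictMonoOn_alphaLo (κ := κ) P.HU.cone.spike.κ_pos
    have := hm.le_iff_le hs (b.collarLo_mem_core P.HU P.hl)
    rw [← this]; linarith [P.alphaLo_collarLo_mem.1, hα.2]
  rw [mu, P.trk_lower hs ⟨hα.1, by linarith [hα.2]⟩ hsc, lev_lowerPt]
  simp only [psiLo, spikeScalar, spikeWin_eq_zero (show b.alphaLo κ s ≤ 7 / 16 by linarith [hα.2])]
  ring

/-- The level on the upper stub (`αHi ∈ [1/4, 3/8]`, upper core): `1 - (4/3)(αHi - 1/4)`. [folklore] -/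
theorem mu_stubHi {s : ℝ} (hs : s ∈ Icc (b.tcHi - b.epsHi / 8) (b.tcHi + b.epsHi / 8)) (hα : b.alphaHi κ s ∈ Icc (1 / 4 : ℝ) (3 / 8)) :
    P.mu s = 1 - 4 / 3 * (b.alphaHi κ s - 1 / 4) := by
  have hsc : b.collarHi P.HU P.hl ≤ s := by
    have hm := b.strictAntiOn_alphaHi (κ := κ) P.HU.cone.spike.κ_pos
    have := hm.le_iff_ge hs (b.collarHi_mem_core P.HU P.hl)
    rw [← this]; linarith [P.alphaHi_collarHi_mem.1, hα.2]
  have hψ : b.psiHi κ lam₀ s = 1 - (b.alphaHi κ s - 1 / 4) / (3 / 4) := by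
    simp only [psiHi, spikeScalar, spikeWin_eq_zero (show b.alphaHi κ s ≤ 7 / 16 by linarith [hα.2])]; ring
  have hψ1 : 9 / 16 ≤ b.psiHi κ lam₀ s ^ 2 := by rw [hψ]; nlinarith [hα.1, hα.2]
  have hφ : bendAng rA (b.psiHi κ lam₀ s) = 0 := by rw [bendAng, annulusCut_of_ge hψ1, mul_zero]
  rw [mu, P.trk_upper hs ⟨hα.1, by linarith [hα.2]⟩ hsc, lev_genPt, levGen, hφ, Real.cos_zero, Real.sin_zero, hψ]
  ring

/-- **The target on the lower stub blend zone** (`αLo ∈ [1/4, 3/8]`, lower core):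
`(αLo, -1 + wCut (αLo) (4/3)(αLo - 1/4))`. [folklore] -/
theorem hh_stubLo {s : ℝ} (hs : s ∈ Icc (b.tcLo - b.epsLo / 8) (b.tcLo + b.epsLo / 8)) (hα : b.alphaLo κ s ∈ Icc (1 / 4 : ℝ) (3 / 8)) :
    P.hh s = pt2 (b.alphaLo κ s) (-1 + wCut (b.alphaLo κ s) * (4 / 3 * (b.alphaLo κ s - 1 / 4))) := by
  have hμ := P.mu_stubLo hs hα
  have ht : -1 + 4 / 3 * (b.alphaLo κ s - 1 / 4) ≤ -(1 / 4) := by linarith [hα.2]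
  have htgt : tgt (P.mu s) = pt2 (b.alphaLo κ s) (-1 + 4 / 3 * (b.alphaLo κ s - 1 / 4)) := by
    rw [hμ, tgt_lev_lowerPt b.depthSign ht, lowerPt_eq, oblPt_apply_zero, oblPt_apply_one]
    congr 1 <;> ring
  rw [hh, P.wCut_alphaHi_of_coreLo hs.2, htgt]
  ext i; fin_cases i
  · simp
  · simp; ring

/-- **The target on the upper stub blend zone** (`αHi ∈ [1/4, 3/8]`, upper core):
`(αHi, 1 - wCut (αHi) (4/3)(αHi - 1/4))`. [folklore] -/
theorem hh_stubHi {s : ℝ} (hs : s ∈ Icc (b.tcHi - b.epsHi / 8) (b.tcHi + b.epsHi / 8)) (hα : b.alphaHi κ s ∈ Icc (1 / 4 : ℝ) (3 / 8)) :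
    P.hh s = pt2 (b.alphaHi κ s) (1 - wCut (b.alphaHi κ s) * (4 / 3 * (b.alphaHi κ s - 1 / 4))) := by
  have hμ := P.mu_stubHi hs hα
  have hm : mB ≤ P.mu s := by rw [hμ]; unfold mB; linarith [hα.2, epsP_pos]
  have htgt : tgt (P.mu s) = pt2 (b.alphaHi κ s) (1 - 4 / 3 * (b.alphaHi κ s - 1 / 4)) := by
    rw [tgt_of_ge hm, hμ]; congr 1; ring
  rw [hh, P.wCut_alphaLo_of_coreHi hs.1, htgt]
  ext i; fin_cases i
  · simp
  · simp; ring

/-- **The target planar curve is `C^∞` on the moving region.** [folklore] -/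
theorem contDiffAt_hh {s : ℝ} (hs : s ∈ Icc (P.paramLo zero_mem07) (P.paramHi zero_mem07)) : ContDiffAt ℝ ∞ P.hh s := by
  have hl : ContDiff ℝ ∞ lev := by
    have e : lev = fun Y : 𝔼 3 ↦ (1 + epsP) / 2 * Y 1 - 2 / 3 * (1 - epsP) * (Y 0 - 1) := funext lev_eq
    rw [e]
    exact (contDiff_const.mul (contDiff_euclidean.1 contDiff_id 1)).sub
      (contDiff_const.mul ((contDiff_euclidean.1 contDiff_id 0).sub contDiff_const))
  have hμ : ContDiffAt ℝ ∞ P.mu s := hl.contDiffAt.comp s (P.contDiffAt_trk hs)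
  have hT : ContDiffAt ℝ ∞ (fun s ↦ tgt (P.mu s)) s := contDiff_tgt.contDiffAt.comp s hμ
  have hA := (b.contDiff_alphaLo κ).contDiffAt (x := s)
  have hA' := (b.contDiff_alphaHi κ).contDiffAt (x := s)
  have hwA : ContDiffAt ℝ ∞ (fun s ↦ 1 - wCut (b.alphaLo κ s)) s := contDiffAt_const.sub (contDiff_wCut.contDiffAt.comp s hA)
  have hwA' : ContDiffAt ℝ ∞ (fun s ↦ 1 - wCut (b.alphaHi κ s)) s := contDiffAt_const.sub (contDiff_wCut.contDiffAt.comp s hA')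
  have hp : ContDiffAt ℝ ∞ (fun s ↦ (pt2 (b.alphaLo κ s) (-1) : 𝔼 2)) s := by
    have : ContDiff ℝ ∞ fun s ↦ (pt2 (b.alphaLo κ s) (-1) : 𝔼 2) := by
      rw [contDiff_euclidean]; intro i; fin_cases i
      · exact b.contDiff_alphaLo κ
      · exact contDiff_const
    exact this.contDiffAt
  have hp' : ContDiffAt ℝ ∞ (fun s ↦ (pt2 (b.alphaHi κ s) 1 : 𝔼 2)) s := by
    have : ContDiff ℝ ∞ fun s ↦ (pt2 (b.alphaHi κ s) 1 : 𝔼 2) := by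
      rw [contDiff_euclidean]; intro i; fin_cases i
      · exact b.contDiff_alphaHi κ
      · exact contDiff_const
    exact this.contDiffAt
  exact (hT.add (hwA.smul (hp.sub hT))).add (hwA'.smul (hp'.sub hT))

end HostHyp

end BandData

end Literature.Topology.FourManifolds
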